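import Summits.BirchSwinnertonDyer.BirchSwinnertonDyer.Theses.ByReductionTypeAtTwo
import Literature.NumberTheory.EllipticCurves.GaloisAction
import HarnessLib

/-!
# Sketch — crux idea `theta-anchor-two` for `OrdMissingLowerBoundAtTwo` (stmt-BirchSwinnertonDyer-19577)

First-lemma signatures only (no proofs claimed beyond the trivial restriction).
The weight-one anchor line: for good ordinary `E/ℚ` at 2 with `E[2]` irreducible and `Δ_E < 0`,
`ρ̄_{E,2}` is the reduction of the odd Artin representation `Ind_k^ℚ ψ`, `k = ℚ(√Δ_E)`,
`ψ` the cubic character cutting out `ℚ(E[2])/k`; its local type at 2 is read off `Δ_E mod ℚ₂^{×2}`.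
-/

set_option linter.dupNamespace false

namespace Summit.BirchSwinnertonDyer.BirchSwinnertonDyer.Cruxes.OrdMissingLowerBoundAtTwo.ThetaAnchor

open Literature.NumberTheory.EllipticCurves.Rank1Residual (GoodOrd)
open Literature.NumberTheory.EllipticCurves.Rank1Residual.Typed (MissingLowerBoundAt)

/-- Split type at 2: the 2-division cubic `4x³ + b₂x² + 2b₄x + b₆` splits over `ℚ₂`,
i.e. `E[2] ⊆ E(ℚ₂)`. -/
def SplitTypeAtTwo (W : WeierstrassCurve ℚ) : Prop :=
  (W.twoTorsionPolynomial.toPoly.map (algebraMap ℚ ℚ_[2])).Splits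

/-- FIRST LEMMA (L1). Good *ordinary* reduction at 2 forces the decomposition group at 2 to act
on `E[2]` through a group of order ≤ 2 (both diagonal characters are trivial mod 2), hence the
2-division cubic has Galois group of order ≤ 2 over `ℚ₂`, and it splits iff its discriminant
`16 Δ` is a square in `ℚ₂`.  Consequently `#E(ℚ₂)[2] ∈ {2, 4}` always (never 1) and
`= 4 ↔ Δ ∈ ℚ₂^{×2}` — census: 633/633 rows of TABLE-TOWER-E1 (`t2loc0 = 2 ↔ Δ ≡ 1 mod 8·□`). -/
def SplitTypeIffIsSquareDisc : Prop :=
  ∀ (W : WeierstrassCurve ℚ) [W.IsElliptic] [W.IsGloballyMinimal],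
    GoodOrd W 2 → (SplitTypeAtTwo W ↔ IsSquare (algebraMap ℚ ℚ_[2] W.Δ))

/-- The weight-one (odd-Artin, non-split) habitat `H_θ`: `E[2]` irreducible, `Δ < 0`
(so `ρ̄_{E,2} = \overline{Ind_k ψ}` with `k = ℚ(√Δ)` imaginary and `θ_ψ` a holomorphic
weight-one newform), and `Δ ∉ ℚ₂^{×2}` (2 inert or ramified in `k`; by (L1) exactly the
non-split type, where `ρ̄(D₂)` has order 2 and mod-2 multiplicity one is available). -/
def ThetaHabitat (W : WeierstrassCurve ℚ) [W.IsElliptic] : Prop :=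
  W.HasIrreducibleModPGaloisRep 2 ∧ W.Δ < 0 ∧ ¬ IsSquare (algebraMap ℚ ℚ_[2] W.Δ)

/-- Regular sub-habitat: `ρ̄_{E,2}` unramified at 2 with `Frob₂` a transposition
(`Δ ∈ 5·ℚ₂^{×2}`, i.e. 2 inert in `k`): the Artin representation is 2-regular
(eigenvalues `+1, -1`), the setting of Greenberg–Vatsal, *Iwasawa theory for Artin
representations I*, §2 (which allows `p = 2`). -/
def ThetaHabitatRegular (W : WeierstrassCurve ℚ) [W.IsElliptic] : Prop :=
  ThetaHabitat W ∧ IsSquare (algebraMap ℚ ℚ_[2] (5 * W.Δ))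

/-- What the line delivers: the crux on `H_θ`. -/
def OrdMissingLowerBoundAtTwoOnThetaHabitat : Prop :=
  ∀ (W : WeierstrassCurve ℚ) [W.IsElliptic] [W.IsGloballyMinimal],
    ¬ W.HasCM → W.analyticRank = 0 → GoodOrd W 2 → ThetaHabitat W → MissingLowerBoundAt W 2

/-- Sanity: the habitat statement is a restriction of the crux (so a proof of it is an honest
partial result toward 19577, and BSD is not proved by any of this). -/
theorem onThetaHabitat_of_crux (h : Theses.ByReductionTypeAtTwo.OrdMissingLowerBoundAtTwo) :
    OrdMissingLowerBoundAtTwoOnThetaHabitat :=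
  fun W _ _ hCM hr hG _ => h W hCM hr hG

end Summit.BirchSwinnertonDyer.BirchSwinnertonDyer.Cruxes.OrdMissingLowerBoundAtTwo.ThetaAnchor
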